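import Summits.Ventures.CertifiedManyBodySolver.Observables.PhaseSeparationExclusionTPrimeStripThermal
import Summits.Ventures.CertifiedManyBodySolver.Observables.PhaseSeparationExclusionBoxThermalFreeDilute
import Summits.Ventures.CertifiedManyBodySolver.Certificates.HubbardTTPrime_freeGC_kernelQuadrature_b8_tpm1o5_dilute
import Summits.Ventures.CertifiedManyBodySolver.Certificates.HubbardTTPrime_freeGC_kernelQuadrature_b8_tp0_dilute
import HarnessLib

/-!
# Ventures/CertifiedManyBodySolver — Observables/PhaseSeparationExclusionTPrimeStripThermalFreeDilute.lean: hubbard-box-p3's competing-order words on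
# the cuprate `t′`-STRIP `t′ ∈ [−1/5, 0] × U ≈ 8` at `T > 0`, RE-PRICED with the FREE-GAS DILUTE ANCHOR — `(≤ 1/5 | ≥ 1)` for every `β ≥ 12` on
# `U ∈ [79/10, 81/10]` (g24: `14`; every `β ≥ 9` on `[8, 81/10]`, was `11`; every `β ≥ 17` on `[15/2, 17/2]`, was `20`), `(≤ 1/4 | ≥ 1)` for every
# `β ≥ 19` (was `22`), `(≤ 3/10 | ≥ 1)` for every `β ≥ 45` (was `55`)

HONEST FRAMING: first certified bounds; not a superconductivity verdict. CLASS = DERIVED / CONTEXT: the free-dilute edition of this seat's g24 file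
`Observables/PhaseSeparationExclusionTPrimeStripThermal.lean` (the `T > 0` `(≤ n₁ | ≥ 1)` sentences at filling `7/8` on hubbard-box-p3's strip between
the `t′ = 0` anchor and the La-214 cell) — CONTROL class (the excluded partner phase is DILUTE: density `≤ 1/5`, `≤ 1/4`, `≤ 3/10`, hole doping `≥ 70 %`);
conditional BY NAME on exactly box-p3's claim nodes (VARBOX plane `cert_obx32x4tpm1o4D1200_openbox_32x4_N112_planes`; K2DIAG-A bootstraps
`cert_laBoxE_K2diag_GU29o5n1tpm3o10_j295889_up` / `cert_laBoxE_K2diag_GU8n1tpm3o10_j299783_up`; registry #21 · #487 · #427 · #488 · #472 · #428),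
on their premise-free kernel Fermi-sea tangent rows (`strip_dilute{1o5,1o4,3o10}_floor`), on the PRODUCER-CERTIFIED `n = 1` anchors
`cert_feC1tt_3x2_tpm5o16_U15o2_b3o4_j290715` (`β_h = 3/4`, band `|t′| ≤ 5/16 × U ≥ 15/2`, left of `U = 8`) and `cert_feC1tt_stair221_tpm1o4_b3o2_j300793`
(cuprate point, `β_h = 3/2`, band `|t′| ≤ 1/4 × U ≥ 8`, right of `U = 8`; `Π(3/2) ≈ 1.4611`), AND — the only change — on the KERNEL free-gas ceilings
`Certificates/HubbardTTPrime_freeGC_kernelQuadrature_b8_{tpm1o5,tp0}_dilute.lean` (no claim node) in place of the dilute entropy caps `2H_b(n₁/2)`: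
the dilute partner's anchor is `p(8; 1, s, U; n₁) ≤ P₀(8, s, μ) − 8μn₁` for every `U ≥ 0` (antitone in `U`, `Literature/…/HubbardTTPrimeFreeGCPressure.lean`),
chorded in `t′` between `s = −1/5` and `s = 0` (`Observables/PhaseSeparationExclusionBoxThermalFreeDilute.lean`); dilute bracket `Q₁(s) + 8 F₁(s) =
0.035 (s = 0) … 0.058 (s = −1/5)` instead of `0.666 / 0.77 / 0.874`. THE CELLS (`t′ ∈ [−1/5, 0]`; exact scan `gen-g25/common.py`; temperature readings on
`t ∈ [0.34, 0.40]` eV [float]):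
* §1 `(≤ 1/5 | ≥ 1)`: columns `U ∈ [79/10, 8]` every `β ≥ 12` (`β₀ = 11.99`; g24 `14`); above `[8, 81/10]` every `β ≥ 9` (`8.42`; g24 `11`); union
  `…beta12_freeDilute` on `[79/10, 81/10]` — `T ≲ 329–387 K`; WIDE: columns `[15/2, 8]` every `β ≥ 17` (`16.49`; g24 `20`), above `[8, 17/2]` every
  `β ≥ 12` (`11.30`; g24 `14`), union `…beta17_wide_freeDilute` on `[15/2, 17/2]` — `T ≲ 232–273 K`;
* §2 `(≤ 1/4 | ≥ 1)` on `[79/10, 81/10]`: columns every `β ≥ 19` (`18.44`; g24 `22`), above every `β ≥ 13` (`12.92`; g24 `17`); union `…beta19_freeDilute`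
  — `T ≲ 208–244 K`;
* §3 `(≤ 3/10 | ≥ 1)` on `[79/10, 81/10]`: columns every `β ≥ 45` (`44.55`; g24 `55`), above every `β ≥ 31` (`30.89`; g24 `42`); union `…beta45_freeDilute`
  — `T ≲ 88–103 K`.
READING (CONTROL): «strip t′/t ∈ [−0.20, 0] × U/t ∈ [7.9, 8.1]: at T ≲ 330 K no canonical thermal state is a macroscopic mixture of the half-filled (or
denser) phase and a phase of hole doping ≥ 80 %; ≥ 75 % at T ≲ 210 K; ≥ 70 % at T ≲ 90 K». Nothing about stripes, SC or `T_c`; no number of record.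

Cell `pub/hubbard-downfold` (D-0096 (ii)/(iii)), seat `hubbard-downfold-unc-2` (g25); forms `psT_not_thermal_mix_{above_column,on_cell_of_columns}_hotAnchorSS`;
generator `gen-g25/gen_W2.py` (exact-ℚ asserts). WHAT THIS IS NOT: a certificate; a CERTIFIED row; the `n₂`-anchors remain PRODUCER-CERTIFIED claim nodes.
References: Israel (1979) Thm I.2.4/I.3.4 [Israel1979]; Emery–Kivelson–Lin PRL 64 (1990) 475 [EmeryKivelsonLin1990]; Poulin–Hastings PRL 106 (2011)
080403 [PoulinHastings2011]; Griffiths J. Math. Phys. 5 (1964) 1215 [Griffiths1966]; Ruelle (1969) §3.3–3.4 [Ruelle1969].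
-/

noncomputable section
namespace Summit.Ventures.CertifiedManyBodySolver.Observables

open Summit.Ventures.CertifiedManyBodySolver.Certificates Summit.Ventures.CertifiedManyBodySolver.Downfold
open Literature.MathematicalPhysics.QuantumLattice Literature.MathematicalPhysics.QuantumLattice.ThermodynamicLimit InfVolFermionState Set Filter

/-! ## §0 The free-gas dilute anchors on the strip `t′ ∈ [−1/5, 0]` -/
/-- **FREE-GAS DILUTE ANCHOR at `n₁ = 1/5` on `t′ ∈ [-1/5, 0]`** (hubbard-box-p3's strip; `β_h = 8`, every `U ≥ 0`): the `t′`-chord of the kernel ceilings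
`P₀(8, -1/5, -619/250) ≤ 629091/1000000` and `P₀(8, 0, -711/250) ≤ 29291/31250` (`Certificates/HubbardTTPrime_freeGC_kernelQuadrature_b8_*_dilute.lean`) Legendre-shifted to
density `1/5`: `p(8; 1, s, U; 1/5) ≤ chord(4.5906910 @ -1/5, 5.4877120 @ 0)` — replaces the a-priori `2H_b(1/5/2)`. [cite: Ruelle1969, §3.4] [cite: Israel1979, Thm. I.3.4] -/
theorem strip_freeDiluteCap_1o5 {s₁ s₂ U₁ U₂ : ℝ} (hs₁ : -1 / 5 ≤ s₁) (hs₂ : s₂ ≤ 0) (hU₁ : 0 ≤ U₁) :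
    ∀ s ∈ Icc s₁ s₂, ∀ U ∈ Icc U₁ U₂, pressureTT' (8 : ℝ) 1 s U (1 / 5 : ℝ) ≤
      ((0 - s) * ((629091 / 1000000 : ℝ) - 8 * (-619 / 250) * (1 / 5)) + (s - (-1 / 5)) * ((29291 / 31250 : ℝ) - 8 * (-711 / 250) * (1 / 5))) /
        (0 - (-1 / 5)) := by
  have hA := freeGCPressureTT'_b8_tpm1o5_n1o5_le
  have hB := freeGCPressureTT'_b8_tp0_n1o5_le
  push_cast at hA hB
  exact pressureTT'_le_schord_of_freeGCPressureTT' (βh := 8) (by norm_num) (n := 1 / 5) (by norm_num) (by norm_num)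
    (sa := -1 / 5) (sb := 0) (by norm_num) hA hB hs₁ hs₂ hU₁

/-- **FREE-GAS DILUTE ANCHOR at `n₁ = 1/4` on `t′ ∈ [-1/5, 0]`** (hubbard-box-p3's strip; `β_h = 8`, every `U ≥ 0`): the `t′`-chord of the kernel ceilings
`P₀(8, -1/5, -288/125) ≤ 469413/500000` and `P₀(8, 0, -2583/1000) ≤ 703461/500000` (`Certificates/HubbardTTPrime_freeGC_kernelQuadrature_b8_*_dilute.lean`) Legendre-shifted to
density `1/4`: `p(8; 1, s, U; 1/4) ≤ chord(5.5468260 @ -1/5, 6.5729220 @ 0)` — replaces the a-priori `2H_b(1/4/2)`. [cite: Ruelle1969, §3.4] [cite: Israel1979, Thm. I.3.4] -/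
theorem strip_freeDiluteCap_1o4 {s₁ s₂ U₁ U₂ : ℝ} (hs₁ : -1 / 5 ≤ s₁) (hs₂ : s₂ ≤ 0) (hU₁ : 0 ≤ U₁) :
    ∀ s ∈ Icc s₁ s₂, ∀ U ∈ Icc U₁ U₂, pressureTT' (8 : ℝ) 1 s U (1 / 4 : ℝ) ≤
      ((0 - s) * ((469413 / 500000 : ℝ) - 8 * (-288 / 125) * (1 / 4)) + (s - (-1 / 5)) * ((703461 / 500000 : ℝ) - 8 * (-2583 / 1000) * (1 / 4))) /
        (0 - (-1 / 5)) := by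
  have hA := freeGCPressureTT'_b8_tpm1o5_n1o4_le
  have hB := freeGCPressureTT'_b8_tp0_n1o4_le
  push_cast at hA hB
  exact pressureTT'_le_schord_of_freeGCPressureTT' (βh := 8) (by norm_num) (n := 1 / 4) (by norm_num) (by norm_num)
    (sa := -1 / 5) (sb := 0) (by norm_num) hA hB hs₁ hs₂ hU₁

/-- **FREE-GAS DILUTE ANCHOR at `n₁ = 3/10` on `t′ ∈ [-1/5, 0]`** (hubbard-box-p3's strip; `β_h = 8`, every `U ≥ 0`): the `t′`-chord of the kernel ceilings
`P₀(8, -1/5, -1069/500) ≤ 130411/100000` and `P₀(8, 0, -1167/500) ≤ 1954441/1000000` (`Certificates/HubbardTTPrime_freeGC_kernelQuadrature_b8_*_dilute.lean`) Legendre-shifted to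
density `3/10`: `p(8; 1, s, U; 3/10) ≤ chord(6.4353100 @ -1/5, 7.5560410 @ 0)` — replaces the a-priori `2H_b(3/10/2)`. [cite: Ruelle1969, §3.4] [cite: Israel1979, Thm. I.3.4] -/
theorem strip_freeDiluteCap_3o10 {s₁ s₂ U₁ U₂ : ℝ} (hs₁ : -1 / 5 ≤ s₁) (hs₂ : s₂ ≤ 0) (hU₁ : 0 ≤ U₁) :
    ∀ s ∈ Icc s₁ s₂, ∀ U ∈ Icc U₁ U₂, pressureTT' (8 : ℝ) 1 s U (3 / 10 : ℝ) ≤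
      ((0 - s) * ((130411 / 100000 : ℝ) - 8 * (-1069 / 500) * (3 / 10)) + (s - (-1 / 5)) * ((1954441 / 1000000 : ℝ) - 8 * (-1167 / 500) * (3 / 10))) /
        (0 - (-1 / 5)) := by
  have hA := freeGCPressureTT'_b8_tpm1o5_n3o10_le
  have hB := freeGCPressureTT'_b8_tp0_n3o10_le
  push_cast at hA hB
  exact pressureTT'_le_schord_of_freeGCPressureTT' (βh := 8) (by norm_num) (n := 3 / 10) (by norm_num) (by norm_num)
    (sa := -1 / 5) (sb := 0) (by norm_num) hA hB hs₁ hs₂ hU₁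

/-! ## §1 `(≤ 1/5 | ≥ 1)` on the strip -/
/-- **`(≤ 1/5 | ≥ 1)`, columns `t′ ∈ [−1/5, 0] × U ∈ [79/10, 8]`, every `β ≥ 12`** (`β₀ = 11.99`; g24 `14`). [cite: Israel1979, Thm. I.2.4] [cite: EmeryKivelsonLin1990, pp. 475–476] [cite: PoulinHastings2011, eqs. (3)–(8)] [cite: Griffiths1966, §II] [cite: Ruelle1969, §3.4] -/
theorem strip78_psTF_1o5_columns79o10_beta12 (hVB : cert_obx32x4tpm1o4D1200_openbox_32x4_N112_planes)
    (hK29 : cert_laBoxE_K2diag_GU29o5n1tpm3o10_j295889_up) (hK8 : cert_laBoxE_K2diag_GU8n1tpm3o10_j299783_up)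
    (h21 : cert_r21_luc_tl_upper_n1_U6) (h487 : cert_r487_hubSQ_hanK7R6_U10_r5_e4_so4blk)
    (h427 : cert_r427_hubSQ_hanK7_U5_r5_e4_so4blk) (h488 : cert_r488_hubSQ_hanK7R6_U6_r5_e4_so4blk)
    (h472 : cert_r472_pb2_tl_upper_n1_U8) (h428 : cert_r428_hubSQ_hanK7R6_U8_r5_e4_so4blk)
    (hLL : cert_feC1tt_3x2_tpm5o16_U15o2_b3o4_j290715)
    {s : ℝ} (hs : s ∈ Icc (-1 / 5 : ℝ) 0) {U : ℝ} (hU : U ∈ Icc (79 / 10 : ℝ) 8)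
    {β : ℝ} (hβ : (12 : ℝ) ≤ β)
    {ω₁ ω₂ : InfVolFermionState 2} (h₁ : ω₁.IsTranslationInvariant) (h₂ : ω₂.IsTranslationInvariant)
    (hρ₁ : 0 < ω₁.density) (hρ₁' : ω₁.density ≤ 1 / 5) (hρ₂ : 1 ≤ ω₂.density) (hρ₂' : ω₂.density < 2)
    {n : ℝ} (hn0 : 0 < n) (hn2 : n < 2) {lam : ℝ} (hl0 : 0 < lam) (hl1 : lam < 1) {Ls : ℕ → ℕ}
    (hLs : Tendsto Ls atTop atTop) :
    ¬ (mix lam hl0.le hl1.le ω₁ ω₂).IsTorusLimitOfMixture (sectorGibbsCount n) (fun L => sectorGibbsWeightTT' β 1 s U n L)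
      (fun L => sectorGibbsVectorTT' 1 s U n L) Ls := by
  refine psT_not_thermal_mix_on_cell_of_columns_hotAnchorSS 1 (s₁ := -1 / 5) (s₂ := 0) (U₁ := 79 / 10) (U₂ := 8)
    (n₁ := 1 / 5) (n₂ := 1) (a := 5 / 32) (b := 27 / 32) (β₀ := 12) (βh₁ := 8) (βh₂ := 3 / 4)
    (by norm_num) (by norm_num) (by norm_num) (by norm_num) (by norm_num) (by norm_num) (by norm_num) (by norm_num)
    (by norm_num) (by norm_num) (by norm_num) (by norm_num) hβ (by norm_num)
    (lsco78_capPlane_on_cell_of hVB (by norm_num) (by norm_num) (by norm_num))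
    (fun s hs => lsco_n1_lawAt_of hK29 hK8 h21 h487 h427 h488 h472 h428 (U₀ := 79 / 10) (by norm_num) s
      ⟨hs.1.trans' (by norm_num), hs.2⟩)
    (fun s hs => lsco_n1_law8_of hK8 h472 h428 s ⟨hs.1.trans' (by norm_num), hs.2⟩)
    (fun s hs U hU => strip_dilute1o5_floor (n₁ := 1 / 5) (by norm_num) (by norm_num) s hs U (by linarith [hU.1]))
    (strip_freeDiluteCap_1o5 (by norm_num) (by norm_num) (by norm_num))
    (lsco_hotCap_n1_b3o4_j290715_on_band hLL (by norm_num) (by norm_num) (by norm_num))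
    ?_ ?_ ?_ ?_ hs hU h₁ h₂ hρ₁ hρ₁' hρ₂ hρ₂' hn0 hn2 hl0 hl1 hLs
  · intro s hs; obtain ⟨h1, h2⟩ := hs; push_cast; norm_num; nlinarith [h1, h2]
  · intro s hs; obtain ⟨h1, h2⟩ := hs; push_cast; norm_num; nlinarith [h1, h2]
  · intro s hs; obtain ⟨h1, h2⟩ := hs; push_cast; norm_num; nlinarith [h1, h2]
  · intro s hs; obtain ⟨h1, h2⟩ := hs; push_cast; norm_num; nlinarith [h1, h2]

/-- **`(≤ 1/5 | ≥ 1)` above: `t′ ∈ [−1/5, 0] × U ∈ [8, 81/10]`, every `β ≥ 9`** (`β₀ = 8.42`; g24 `11`; `n₂`-anchor `β_h = 3/2`). [cite: Israel1979, Thm. I.2.4] [cite: EmeryKivelsonLin1990, pp. 475–476] [cite: PoulinHastings2011, eqs. (3)–(8)] [cite: Griffiths1966, §II] [cite: Ruelle1969, §3.4] -/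
theorem strip78_psTF_1o5_above81o10_beta9 (hVB : cert_obx32x4tpm1o4D1200_openbox_32x4_N112_planes)
    (hK8 : cert_laBoxE_K2diag_GU8n1tpm3o10_j299783_up)
    (h472 : cert_r472_pb2_tl_upper_n1_U8) (h428 : cert_r428_hubSQ_hanK7R6_U8_r5_e4_so4blk)
    (hC1 : cert_feC1tt_stair221_tpm1o4_b3o2_j300793)
    {s : ℝ} (hs : s ∈ Icc (-1 / 5 : ℝ) 0) {U : ℝ} (hU : U ∈ Icc (8 : ℝ) (81 / 10))
    {β : ℝ} (hβ : (9 : ℝ) ≤ β)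
    {ω₁ ω₂ : InfVolFermionState 2} (h₁ : ω₁.IsTranslationInvariant) (h₂ : ω₂.IsTranslationInvariant)
    (hρ₁ : 0 < ω₁.density) (hρ₁' : ω₁.density ≤ 1 / 5) (hρ₂ : 1 ≤ ω₂.density) (hρ₂' : ω₂.density < 2)
    {n : ℝ} (hn0 : 0 < n) (hn2 : n < 2) {lam : ℝ} (hl0 : 0 < lam) (hl1 : lam < 1) {Ls : ℕ → ℕ}
    (hLs : Tendsto Ls atTop atTop) :
    ¬ (mix lam hl0.le hl1.le ω₁ ω₂).IsTorusLimitOfMixture (sectorGibbsCount n) (fun L => sectorGibbsWeightTT' β 1 s U n L)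
      (fun L => sectorGibbsVectorTT' 1 s U n L) Ls := by
  refine psT_not_thermal_mix_above_column_hotAnchorSS 1 (s₁ := -1 / 5) (s₂ := 0) (U₂ := 8) (U₃ := 81 / 10)
    (n₁ := 1 / 5) (n₂ := 1) (a := 5 / 32) (b := 27 / 32) (β₀ := 9) (βh₁ := 8) (βh₂ := 3 / 2)
    (by norm_num) (by norm_num) (by norm_num) (by norm_num) (by norm_num) (by norm_num) (by norm_num) (by norm_num)
    (by norm_num) (by norm_num) (by norm_num) (by norm_num) hβ (by norm_num)
    (lsco78_capPlane_on_cell_of hVB (by norm_num) (by norm_num) (by norm_num))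
    (fun s hs => lsco_n1_law8_of hK8 h472 h428 s ⟨hs.1.trans' (by norm_num), hs.2⟩)
    (fun s hs U hU => strip_dilute1o5_floor (n₁ := 1 / 5) (by norm_num) (by norm_num) s hs U (by linarith [hU.1]))
    (strip_freeDiluteCap_1o5 (by norm_num) (by norm_num) (by norm_num))
    (lsco_hotCap_n1_b3o2_j300793_on_cell hC1 (by norm_num) (by norm_num) (by norm_num))
    ?_ ?_ hs hU h₁ h₂ hρ₁ hρ₁' hρ₂ hρ₂' hn0 hn2 hl0 hl1 hLs
  · intro s hs; obtain ⟨h1, h2⟩ := hs; push_cast; norm_num; nlinarith [h1, h2]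
  · intro s hs; obtain ⟨h1, h2⟩ := hs; push_cast; norm_num; nlinarith [h1, h2]

/-- **`(≤ 1/5 | ≥ 1)` on `t′ ∈ [−1/5, 0] × U ∈ [79/10, 81/10]`, every `β ≥ 12`** (g24 `strip78_not_thermal_mix_le_1o5_ge_one_beta14`: `14`) — `T ≲ 329–387 K`. [cite: Israel1979, Thm. I.2.4] [cite: EmeryKivelsonLin1990, pp. 475–476] [cite: PoulinHastings2011, eqs. (3)–(8)] [cite: Griffiths1966, §II] [cite: Ruelle1969, §3.4] -/
theorem strip78_not_thermal_mix_le_1o5_ge_one_beta12_freeDilute (hVB : cert_obx32x4tpm1o4D1200_openbox_32x4_N112_planes)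
    (hK29 : cert_laBoxE_K2diag_GU29o5n1tpm3o10_j295889_up) (hK8 : cert_laBoxE_K2diag_GU8n1tpm3o10_j299783_up)
    (h21 : cert_r21_luc_tl_upper_n1_U6) (h487 : cert_r487_hubSQ_hanK7R6_U10_r5_e4_so4blk)
    (h427 : cert_r427_hubSQ_hanK7_U5_r5_e4_so4blk) (h488 : cert_r488_hubSQ_hanK7R6_U6_r5_e4_so4blk)
    (h472 : cert_r472_pb2_tl_upper_n1_U8) (h428 : cert_r428_hubSQ_hanK7R6_U8_r5_e4_so4blk)
    (hLL : cert_feC1tt_3x2_tpm5o16_U15o2_b3o4_j290715) (hC1 : cert_feC1tt_stair221_tpm1o4_b3o2_j300793)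
    {s : ℝ} (hs : s ∈ Icc (-1 / 5 : ℝ) 0) {U : ℝ} (hU : U ∈ Icc (79 / 10 : ℝ) (81 / 10))
    {β : ℝ} (hβ : (12 : ℝ) ≤ β)
    {ω₁ ω₂ : InfVolFermionState 2} (h₁ : ω₁.IsTranslationInvariant) (h₂ : ω₂.IsTranslationInvariant)
    (hρ₁ : 0 < ω₁.density) (hρ₁' : ω₁.density ≤ 1 / 5) (hρ₂ : 1 ≤ ω₂.density) (hρ₂' : ω₂.density < 2)
    {n : ℝ} (hn0 : 0 < n) (hn2 : n < 2) {lam : ℝ} (hl0 : 0 < lam) (hl1 : lam < 1) {Ls : ℕ → ℕ}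
    (hLs : Tendsto Ls atTop atTop) :
    ¬ (mix lam hl0.le hl1.le ω₁ ω₂).IsTorusLimitOfMixture (sectorGibbsCount n) (fun L => sectorGibbsWeightTT' β 1 s U n L)
      (fun L => sectorGibbsVectorTT' 1 s U n L) Ls := by
  rcases le_total U 8 with hUl | hUr
  · exact strip78_psTF_1o5_columns79o10_beta12 hVB hK29 hK8 h21 h487 h427 h488 h472 h428 hLL hs ⟨hU.1, hUl⟩ (hβ.trans' (by norm_num)) h₁ h₂ hρ₁ hρ₁' hρ₂ hρ₂' hn0 hn2 hl0 hl1 hLs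
  · exact strip78_psTF_1o5_above81o10_beta9 hVB hK8 h472 h428 hC1 hs ⟨hUr, hU.2⟩ (hβ.trans' (by norm_num)) h₁ h₂ hρ₁ hρ₁' hρ₂ hρ₂' hn0 hn2 hl0 hl1 hLs

/-- **`(≤ 1/5 | ≥ 1)`, wide columns `t′ ∈ [−1/5, 0] × U ∈ [15/2, 8]`, every `β ≥ 17`** (`β₀ = 16.49`; g24 `20`). [cite: Israel1979, Thm. I.2.4] [cite: EmeryKivelsonLin1990, pp. 475–476] [cite: PoulinHastings2011, eqs. (3)–(8)] [cite: Griffiths1966, §II] [cite: Ruelle1969, §3.4] -/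
theorem strip78_psTF_1o5_columns15o2_beta17 (hVB : cert_obx32x4tpm1o4D1200_openbox_32x4_N112_planes)
    (hK29 : cert_laBoxE_K2diag_GU29o5n1tpm3o10_j295889_up) (hK8 : cert_laBoxE_K2diag_GU8n1tpm3o10_j299783_up)
    (h21 : cert_r21_luc_tl_upper_n1_U6) (h487 : cert_r487_hubSQ_hanK7R6_U10_r5_e4_so4blk)
    (h427 : cert_r427_hubSQ_hanK7_U5_r5_e4_so4blk) (h488 : cert_r488_hubSQ_hanK7R6_U6_r5_e4_so4blk)
    (h472 : cert_r472_pb2_tl_upper_n1_U8) (h428 : cert_r428_hubSQ_hanK7R6_U8_r5_e4_so4blk)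
    (hLL : cert_feC1tt_3x2_tpm5o16_U15o2_b3o4_j290715)
    {s : ℝ} (hs : s ∈ Icc (-1 / 5 : ℝ) 0) {U : ℝ} (hU : U ∈ Icc (15 / 2 : ℝ) 8)
    {β : ℝ} (hβ : (17 : ℝ) ≤ β)
    {ω₁ ω₂ : InfVolFermionState 2} (h₁ : ω₁.IsTranslationInvariant) (h₂ : ω₂.IsTranslationInvariant)
    (hρ₁ : 0 < ω₁.density) (hρ₁' : ω₁.density ≤ 1 / 5) (hρ₂ : 1 ≤ ω₂.density) (hρ₂' : ω₂.density < 2)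
    {n : ℝ} (hn0 : 0 < n) (hn2 : n < 2) {lam : ℝ} (hl0 : 0 < lam) (hl1 : lam < 1) {Ls : ℕ → ℕ}
    (hLs : Tendsto Ls atTop atTop) :
    ¬ (mix lam hl0.le hl1.le ω₁ ω₂).IsTorusLimitOfMixture (sectorGibbsCount n) (fun L => sectorGibbsWeightTT' β 1 s U n L)
      (fun L => sectorGibbsVectorTT' 1 s U n L) Ls := by
  refine psT_not_thermal_mix_on_cell_of_columns_hotAnchorSS 1 (s₁ := -1 / 5) (s₂ := 0) (U₁ := 15 / 2) (U₂ := 8)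
    (n₁ := 1 / 5) (n₂ := 1) (a := 5 / 32) (b := 27 / 32) (β₀ := 17) (βh₁ := 8) (βh₂ := 3 / 4)
    (by norm_num) (by norm_num) (by norm_num) (by norm_num) (by norm_num) (by norm_num) (by norm_num) (by norm_num)
    (by norm_num) (by norm_num) (by norm_num) (by norm_num) hβ (by norm_num)
    (lsco78_capPlane_on_cell_of hVB (by norm_num) (by norm_num) (by norm_num))
    (fun s hs => lsco_n1_lawAt_of hK29 hK8 h21 h487 h427 h488 h472 h428 (U₀ := 15 / 2) (by norm_num) s
      ⟨hs.1.trans' (by norm_num), hs.2⟩)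
    (fun s hs => lsco_n1_law8_of hK8 h472 h428 s ⟨hs.1.trans' (by norm_num), hs.2⟩)
    (fun s hs U hU => strip_dilute1o5_floor (n₁ := 1 / 5) (by norm_num) (by norm_num) s hs U (by linarith [hU.1]))
    (strip_freeDiluteCap_1o5 (by norm_num) (by norm_num) (by norm_num))
    (lsco_hotCap_n1_b3o4_j290715_on_band hLL (by norm_num) (by norm_num) (by norm_num))
    ?_ ?_ ?_ ?_ hs hU h₁ h₂ hρ₁ hρ₁' hρ₂ hρ₂' hn0 hn2 hl0 hl1 hLs
  · intro s hs; obtain ⟨h1, h2⟩ := hs; push_cast; norm_num; nlinarith [h1, h2]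
  · intro s hs; obtain ⟨h1, h2⟩ := hs; push_cast; norm_num; nlinarith [h1, h2]
  · intro s hs; obtain ⟨h1, h2⟩ := hs; push_cast; norm_num; nlinarith [h1, h2]
  · intro s hs; obtain ⟨h1, h2⟩ := hs; push_cast; norm_num; nlinarith [h1, h2]

/-- **`(≤ 1/5 | ≥ 1)` above: `t′ ∈ [−1/5, 0] × U ∈ [8, 17/2]`, every `β ≥ 12`** (`β₀ = 11.30`; g24 `14`). [cite: Israel1979, Thm. I.2.4] [cite: EmeryKivelsonLin1990, pp. 475–476] [cite: PoulinHastings2011, eqs. (3)–(8)] [cite: Griffiths1966, §II] [cite: Ruelle1969, §3.4] -/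
theorem strip78_psTF_1o5_above17o2_beta12 (hVB : cert_obx32x4tpm1o4D1200_openbox_32x4_N112_planes)
    (hK8 : cert_laBoxE_K2diag_GU8n1tpm3o10_j299783_up)
    (h472 : cert_r472_pb2_tl_upper_n1_U8) (h428 : cert_r428_hubSQ_hanK7R6_U8_r5_e4_so4blk)
    (hC1 : cert_feC1tt_stair221_tpm1o4_b3o2_j300793)
    {s : ℝ} (hs : s ∈ Icc (-1 / 5 : ℝ) 0) {U : ℝ} (hU : U ∈ Icc (8 : ℝ) (17 / 2))
    {β : ℝ} (hβ : (12 : ℝ) ≤ β)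
    {ω₁ ω₂ : InfVolFermionState 2} (h₁ : ω₁.IsTranslationInvariant) (h₂ : ω₂.IsTranslationInvariant)
    (hρ₁ : 0 < ω₁.density) (hρ₁' : ω₁.density ≤ 1 / 5) (hρ₂ : 1 ≤ ω₂.density) (hρ₂' : ω₂.density < 2)
    {n : ℝ} (hn0 : 0 < n) (hn2 : n < 2) {lam : ℝ} (hl0 : 0 < lam) (hl1 : lam < 1) {Ls : ℕ → ℕ}
    (hLs : Tendsto Ls atTop atTop) :
    ¬ (mix lam hl0.le hl1.le ω₁ ω₂).IsTorusLimitOfMixture (sectorGibbsCount n) (fun L => sectorGibbsWeightTT' β 1 s U n L)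
      (fun L => sectorGibbsVectorTT' 1 s U n L) Ls := by
  refine psT_not_thermal_mix_above_column_hotAnchorSS 1 (s₁ := -1 / 5) (s₂ := 0) (U₂ := 8) (U₃ := 17 / 2)
    (n₁ := 1 / 5) (n₂ := 1) (a := 5 / 32) (b := 27 / 32) (β₀ := 12) (βh₁ := 8) (βh₂ := 3 / 2)
    (by norm_num) (by norm_num) (by norm_num) (by norm_num) (by norm_num) (by norm_num) (by norm_num) (by norm_num)
    (by norm_num) (by norm_num) (by norm_num) (by norm_num) hβ (by norm_num)
    (lsco78_capPlane_on_cell_of hVB (by norm_num) (by norm_num) (by norm_num))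
    (fun s hs => lsco_n1_law8_of hK8 h472 h428 s ⟨hs.1.trans' (by norm_num), hs.2⟩)
    (fun s hs U hU => strip_dilute1o5_floor (n₁ := 1 / 5) (by norm_num) (by norm_num) s hs U (by linarith [hU.1]))
    (strip_freeDiluteCap_1o5 (by norm_num) (by norm_num) (by norm_num))
    (lsco_hotCap_n1_b3o2_j300793_on_cell hC1 (by norm_num) (by norm_num) (by norm_num))
    ?_ ?_ hs hU h₁ h₂ hρ₁ hρ₁' hρ₂ hρ₂' hn0 hn2 hl0 hl1 hLs
  · intro s hs; obtain ⟨h1, h2⟩ := hs; push_cast; norm_num; nlinarith [h1, h2]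
  · intro s hs; obtain ⟨h1, h2⟩ := hs; push_cast; norm_num; nlinarith [h1, h2]

/-- **`(≤ 1/5 | ≥ 1)` on the WIDE cell `t′ ∈ [−1/5, 0] × U ∈ [15/2, 17/2]`, every `β ≥ 17`** (g24: `20`) — `T ≲ 232–273 K`. [cite: Israel1979, Thm. I.2.4] [cite: EmeryKivelsonLin1990, pp. 475–476] [cite: PoulinHastings2011, eqs. (3)–(8)] [cite: Griffiths1966, §II] [cite: Ruelle1969, §3.4] -/
theorem strip78_not_thermal_mix_le_1o5_ge_one_beta17_wide_freeDilute (hVB : cert_obx32x4tpm1o4D1200_openbox_32x4_N112_planes)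
    (hK29 : cert_laBoxE_K2diag_GU29o5n1tpm3o10_j295889_up) (hK8 : cert_laBoxE_K2diag_GU8n1tpm3o10_j299783_up)
    (h21 : cert_r21_luc_tl_upper_n1_U6) (h487 : cert_r487_hubSQ_hanK7R6_U10_r5_e4_so4blk)
    (h427 : cert_r427_hubSQ_hanK7_U5_r5_e4_so4blk) (h488 : cert_r488_hubSQ_hanK7R6_U6_r5_e4_so4blk)
    (h472 : cert_r472_pb2_tl_upper_n1_U8) (h428 : cert_r428_hubSQ_hanK7R6_U8_r5_e4_so4blk)
    (hLL : cert_feC1tt_3x2_tpm5o16_U15o2_b3o4_j290715) (hC1 : cert_feC1tt_stair221_tpm1o4_b3o2_j300793)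
    {s : ℝ} (hs : s ∈ Icc (-1 / 5 : ℝ) 0) {U : ℝ} (hU : U ∈ Icc (15 / 2 : ℝ) (17 / 2))
    {β : ℝ} (hβ : (17 : ℝ) ≤ β)
    {ω₁ ω₂ : InfVolFermionState 2} (h₁ : ω₁.IsTranslationInvariant) (h₂ : ω₂.IsTranslationInvariant)
    (hρ₁ : 0 < ω₁.density) (hρ₁' : ω₁.density ≤ 1 / 5) (hρ₂ : 1 ≤ ω₂.density) (hρ₂' : ω₂.density < 2)
    {n : ℝ} (hn0 : 0 < n) (hn2 : n < 2) {lam : ℝ} (hl0 : 0 < lam) (hl1 : lam < 1) {Ls : ℕ → ℕ}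
    (hLs : Tendsto Ls atTop atTop) :
    ¬ (mix lam hl0.le hl1.le ω₁ ω₂).IsTorusLimitOfMixture (sectorGibbsCount n) (fun L => sectorGibbsWeightTT' β 1 s U n L)
      (fun L => sectorGibbsVectorTT' 1 s U n L) Ls := by
  rcases le_total U 8 with hUl | hUr
  · exact strip78_psTF_1o5_columns15o2_beta17 hVB hK29 hK8 h21 h487 h427 h488 h472 h428 hLL hs ⟨hU.1, hUl⟩ (hβ.trans' (by norm_num)) h₁ h₂ hρ₁ hρ₁' hρ₂ hρ₂' hn0 hn2 hl0 hl1 hLs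
  · exact strip78_psTF_1o5_above17o2_beta12 hVB hK8 h472 h428 hC1 hs ⟨hUr, hU.2⟩ (hβ.trans' (by norm_num)) h₁ h₂ hρ₁ hρ₁' hρ₂ hρ₂' hn0 hn2 hl0 hl1 hLs

/-! ## §2 `(≤ 1/4 | ≥ 1)` on the strip, `U ∈ [79/10, 81/10]` -/
/-- **`(≤ 1/4 | ≥ 1)`, columns `U ∈ [79/10, 8]`, every `β ≥ 19`** (`β₀ = 18.44`; g24 `22`). [cite: Israel1979, Thm. I.2.4] [cite: EmeryKivelsonLin1990, pp. 475–476] [cite: PoulinHastings2011, eqs. (3)–(8)] [cite: Griffiths1966, §II] [cite: Ruelle1969, §3.4] -/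
theorem strip78_psTF_1o4_columns79o10_beta19 (hVB : cert_obx32x4tpm1o4D1200_openbox_32x4_N112_planes)
    (hK29 : cert_laBoxE_K2diag_GU29o5n1tpm3o10_j295889_up) (hK8 : cert_laBoxE_K2diag_GU8n1tpm3o10_j299783_up)
    (h21 : cert_r21_luc_tl_upper_n1_U6) (h487 : cert_r487_hubSQ_hanK7R6_U10_r5_e4_so4blk)
    (h427 : cert_r427_hubSQ_hanK7_U5_r5_e4_so4blk) (h488 : cert_r488_hubSQ_hanK7R6_U6_r5_e4_so4blk)
    (h472 : cert_r472_pb2_tl_upper_n1_U8) (h428 : cert_r428_hubSQ_hanK7R6_U8_r5_e4_so4blk)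
    (hLL : cert_feC1tt_3x2_tpm5o16_U15o2_b3o4_j290715)
    {s : ℝ} (hs : s ∈ Icc (-1 / 5 : ℝ) 0) {U : ℝ} (hU : U ∈ Icc (79 / 10 : ℝ) 8)
    {β : ℝ} (hβ : (19 : ℝ) ≤ β)
    {ω₁ ω₂ : InfVolFermionState 2} (h₁ : ω₁.IsTranslationInvariant) (h₂ : ω₂.IsTranslationInvariant)
    (hρ₁ : 0 < ω₁.density) (hρ₁' : ω₁.density ≤ 1 / 4) (hρ₂ : 1 ≤ ω₂.density) (hρ₂' : ω₂.density < 2)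
    {n : ℝ} (hn0 : 0 < n) (hn2 : n < 2) {lam : ℝ} (hl0 : 0 < lam) (hl1 : lam < 1) {Ls : ℕ → ℕ}
    (hLs : Tendsto Ls atTop atTop) :
    ¬ (mix lam hl0.le hl1.le ω₁ ω₂).IsTorusLimitOfMixture (sectorGibbsCount n) (fun L => sectorGibbsWeightTT' β 1 s U n L)
      (fun L => sectorGibbsVectorTT' 1 s U n L) Ls := by
  refine psT_not_thermal_mix_on_cell_of_columns_hotAnchorSS 1 (s₁ := -1 / 5) (s₂ := 0) (U₁ := 79 / 10) (U₂ := 8)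
    (n₁ := 1 / 4) (n₂ := 1) (a := 1 / 6) (b := 5 / 6) (β₀ := 19) (βh₁ := 8) (βh₂ := 3 / 4)
    (by norm_num) (by norm_num) (by norm_num) (by norm_num) (by norm_num) (by norm_num) (by norm_num) (by norm_num)
    (by norm_num) (by norm_num) (by norm_num) (by norm_num) hβ (by norm_num)
    (lsco78_capPlane_on_cell_of hVB (by norm_num) (by norm_num) (by norm_num))
    (fun s hs => lsco_n1_lawAt_of hK29 hK8 h21 h487 h427 h488 h472 h428 (U₀ := 79 / 10) (by norm_num) s
      ⟨hs.1.trans' (by norm_num), hs.2⟩)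
    (fun s hs => lsco_n1_law8_of hK8 h472 h428 s ⟨hs.1.trans' (by norm_num), hs.2⟩)
    (fun s hs U hU => strip_dilute1o4_floor (n₁ := 1 / 4) (by norm_num) (by norm_num) s hs U (by linarith [hU.1]))
    (strip_freeDiluteCap_1o4 (by norm_num) (by norm_num) (by norm_num))
    (lsco_hotCap_n1_b3o4_j290715_on_band hLL (by norm_num) (by norm_num) (by norm_num))
    ?_ ?_ ?_ ?_ hs hU h₁ h₂ hρ₁ hρ₁' hρ₂ hρ₂' hn0 hn2 hl0 hl1 hLs
  · intro s hs; obtain ⟨h1, h2⟩ := hs; push_cast; norm_num; nlinarith [h1, h2]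
  · intro s hs; obtain ⟨h1, h2⟩ := hs; push_cast; norm_num; nlinarith [h1, h2]
  · intro s hs; obtain ⟨h1, h2⟩ := hs; push_cast; norm_num; nlinarith [h1, h2]
  · intro s hs; obtain ⟨h1, h2⟩ := hs; push_cast; norm_num; nlinarith [h1, h2]

/-- **`(≤ 1/4 | ≥ 1)` above `[8, 81/10]`, every `β ≥ 13`** (`β₀ = 12.92`; g24 `17`). [cite: Israel1979, Thm. I.2.4] [cite: EmeryKivelsonLin1990, pp. 475–476] [cite: PoulinHastings2011, eqs. (3)–(8)] [cite: Griffiths1966, §II] [cite: Ruelle1969, §3.4] -/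
theorem strip78_psTF_1o4_above81o10_beta13 (hVB : cert_obx32x4tpm1o4D1200_openbox_32x4_N112_planes)
    (hK8 : cert_laBoxE_K2diag_GU8n1tpm3o10_j299783_up)
    (h472 : cert_r472_pb2_tl_upper_n1_U8) (h428 : cert_r428_hubSQ_hanK7R6_U8_r5_e4_so4blk)
    (hC1 : cert_feC1tt_stair221_tpm1o4_b3o2_j300793)
    {s : ℝ} (hs : s ∈ Icc (-1 / 5 : ℝ) 0) {U : ℝ} (hU : U ∈ Icc (8 : ℝ) (81 / 10))
    {β : ℝ} (hβ : (13 : ℝ) ≤ β)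
    {ω₁ ω₂ : InfVolFermionState 2} (h₁ : ω₁.IsTranslationInvariant) (h₂ : ω₂.IsTranslationInvariant)
    (hρ₁ : 0 < ω₁.density) (hρ₁' : ω₁.density ≤ 1 / 4) (hρ₂ : 1 ≤ ω₂.density) (hρ₂' : ω₂.density < 2)
    {n : ℝ} (hn0 : 0 < n) (hn2 : n < 2) {lam : ℝ} (hl0 : 0 < lam) (hl1 : lam < 1) {Ls : ℕ → ℕ}
    (hLs : Tendsto Ls atTop atTop) :
    ¬ (mix lam hl0.le hl1.le ω₁ ω₂).IsTorusLimitOfMixture (sectorGibbsCount n) (fun L => sectorGibbsWeightTT' β 1 s U n L)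
      (fun L => sectorGibbsVectorTT' 1 s U n L) Ls := by
  refine psT_not_thermal_mix_above_column_hotAnchorSS 1 (s₁ := -1 / 5) (s₂ := 0) (U₂ := 8) (U₃ := 81 / 10)
    (n₁ := 1 / 4) (n₂ := 1) (a := 1 / 6) (b := 5 / 6) (β₀ := 13) (βh₁ := 8) (βh₂ := 3 / 2)
    (by norm_num) (by norm_num) (by norm_num) (by norm_num) (by norm_num) (by norm_num) (by norm_num) (by norm_num)
    (by norm_num) (by norm_num) (by norm_num) (by norm_num) hβ (by norm_num)
    (lsco78_capPlane_on_cell_of hVB (by norm_num) (by norm_num) (by norm_num))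
    (fun s hs => lsco_n1_law8_of hK8 h472 h428 s ⟨hs.1.trans' (by norm_num), hs.2⟩)
    (fun s hs U hU => strip_dilute1o4_floor (n₁ := 1 / 4) (by norm_num) (by norm_num) s hs U (by linarith [hU.1]))
    (strip_freeDiluteCap_1o4 (by norm_num) (by norm_num) (by norm_num))
    (lsco_hotCap_n1_b3o2_j300793_on_cell hC1 (by norm_num) (by norm_num) (by norm_num))
    ?_ ?_ hs hU h₁ h₂ hρ₁ hρ₁' hρ₂ hρ₂' hn0 hn2 hl0 hl1 hLs
  · intro s hs; obtain ⟨h1, h2⟩ := hs; push_cast; norm_num; nlinarith [h1, h2]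
  · intro s hs; obtain ⟨h1, h2⟩ := hs; push_cast; norm_num; nlinarith [h1, h2]

/-- **`(≤ 1/4 | ≥ 1)` on `t′ ∈ [−1/5, 0] × U ∈ [79/10, 81/10]`, every `β ≥ 19`** (g24: `22`) — `T ≲ 208–244 K`. [cite: Israel1979, Thm. I.2.4] [cite: EmeryKivelsonLin1990, pp. 475–476] [cite: PoulinHastings2011, eqs. (3)–(8)] [cite: Griffiths1966, §II] [cite: Ruelle1969, §3.4] -/
theorem strip78_not_thermal_mix_le_1o4_ge_one_beta19_freeDilute (hVB : cert_obx32x4tpm1o4D1200_openbox_32x4_N112_planes)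
    (hK29 : cert_laBoxE_K2diag_GU29o5n1tpm3o10_j295889_up) (hK8 : cert_laBoxE_K2diag_GU8n1tpm3o10_j299783_up)
    (h21 : cert_r21_luc_tl_upper_n1_U6) (h487 : cert_r487_hubSQ_hanK7R6_U10_r5_e4_so4blk)
    (h427 : cert_r427_hubSQ_hanK7_U5_r5_e4_so4blk) (h488 : cert_r488_hubSQ_hanK7R6_U6_r5_e4_so4blk)
    (h472 : cert_r472_pb2_tl_upper_n1_U8) (h428 : cert_r428_hubSQ_hanK7R6_U8_r5_e4_so4blk)
    (hLL : cert_feC1tt_3x2_tpm5o16_U15o2_b3o4_j290715) (hC1 : cert_feC1tt_stair221_tpm1o4_b3o2_j300793)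
    {s : ℝ} (hs : s ∈ Icc (-1 / 5 : ℝ) 0) {U : ℝ} (hU : U ∈ Icc (79 / 10 : ℝ) (81 / 10))
    {β : ℝ} (hβ : (19 : ℝ) ≤ β)
    {ω₁ ω₂ : InfVolFermionState 2} (h₁ : ω₁.IsTranslationInvariant) (h₂ : ω₂.IsTranslationInvariant)
    (hρ₁ : 0 < ω₁.density) (hρ₁' : ω₁.density ≤ 1 / 4) (hρ₂ : 1 ≤ ω₂.density) (hρ₂' : ω₂.density < 2)
    {n : ℝ} (hn0 : 0 < n) (hn2 : n < 2) {lam : ℝ} (hl0 : 0 < lam) (hl1 : lam < 1) {Ls : ℕ → ℕ}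
    (hLs : Tendsto Ls atTop atTop) :
    ¬ (mix lam hl0.le hl1.le ω₁ ω₂).IsTorusLimitOfMixture (sectorGibbsCount n) (fun L => sectorGibbsWeightTT' β 1 s U n L)
      (fun L => sectorGibbsVectorTT' 1 s U n L) Ls := by
  rcases le_total U 8 with hUl | hUr
  · exact strip78_psTF_1o4_columns79o10_beta19 hVB hK29 hK8 h21 h487 h427 h488 h472 h428 hLL hs ⟨hU.1, hUl⟩ (hβ.trans' (by norm_num)) h₁ h₂ hρ₁ hρ₁' hρ₂ hρ₂' hn0 hn2 hl0 hl1 hLs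
  · exact strip78_psTF_1o4_above81o10_beta13 hVB hK8 h472 h428 hC1 hs ⟨hUr, hU.2⟩ (hβ.trans' (by norm_num)) h₁ h₂ hρ₁ hρ₁' hρ₂ hρ₂' hn0 hn2 hl0 hl1 hLs

/-! ## §3 `(≤ 3/10 | ≥ 1)` on the strip, `U ∈ [79/10, 81/10]` -/
/-- **`(≤ 3/10 | ≥ 1)`, columns `U ∈ [79/10, 8]`, every `β ≥ 45`** (`β₀ = 44.55`; g24 `55`; the `T = 0` margins are `0.014` here). [cite: Israel1979, Thm. I.2.4] [cite: EmeryKivelsonLin1990, pp. 475–476] [cite: PoulinHastings2011, eqs. (3)–(8)] [cite: Griffiths1966, §II] [cite: Ruelle1969, §3.4] -/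
theorem strip78_psTF_3o10_columns79o10_beta45 (hVB : cert_obx32x4tpm1o4D1200_openbox_32x4_N112_planes)
    (hK29 : cert_laBoxE_K2diag_GU29o5n1tpm3o10_j295889_up) (hK8 : cert_laBoxE_K2diag_GU8n1tpm3o10_j299783_up)
    (h21 : cert_r21_luc_tl_upper_n1_U6) (h487 : cert_r487_hubSQ_hanK7R6_U10_r5_e4_so4blk)
    (h427 : cert_r427_hubSQ_hanK7_U5_r5_e4_so4blk) (h488 : cert_r488_hubSQ_hanK7R6_U6_r5_e4_so4blk)
    (h472 : cert_r472_pb2_tl_upper_n1_U8) (h428 : cert_r428_hubSQ_hanK7R6_U8_r5_e4_so4blk)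
    (hLL : cert_feC1tt_3x2_tpm5o16_U15o2_b3o4_j290715)
    {s : ℝ} (hs : s ∈ Icc (-1 / 5 : ℝ) 0) {U : ℝ} (hU : U ∈ Icc (79 / 10 : ℝ) 8)
    {β : ℝ} (hβ : (45 : ℝ) ≤ β)
    {ω₁ ω₂ : InfVolFermionState 2} (h₁ : ω₁.IsTranslationInvariant) (h₂ : ω₂.IsTranslationInvariant)
    (hρ₁ : 0 < ω₁.density) (hρ₁' : ω₁.density ≤ 3 / 10) (hρ₂ : 1 ≤ ω₂.density) (hρ₂' : ω₂.density < 2)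
    {n : ℝ} (hn0 : 0 < n) (hn2 : n < 2) {lam : ℝ} (hl0 : 0 < lam) (hl1 : lam < 1) {Ls : ℕ → ℕ}
    (hLs : Tendsto Ls atTop atTop) :
    ¬ (mix lam hl0.le hl1.le ω₁ ω₂).IsTorusLimitOfMixture (sectorGibbsCount n) (fun L => sectorGibbsWeightTT' β 1 s U n L)
      (fun L => sectorGibbsVectorTT' 1 s U n L) Ls := by
  refine psT_not_thermal_mix_on_cell_of_columns_hotAnchorSS 1 (s₁ := -1 / 5) (s₂ := 0) (U₁ := 79 / 10) (U₂ := 8)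
    (n₁ := 3 / 10) (n₂ := 1) (a := 5 / 28) (b := 23 / 28) (β₀ := 45) (βh₁ := 8) (βh₂ := 3 / 4)
    (by norm_num) (by norm_num) (by norm_num) (by norm_num) (by norm_num) (by norm_num) (by norm_num) (by norm_num)
    (by norm_num) (by norm_num) (by norm_num) (by norm_num) hβ (by norm_num)
    (lsco78_capPlane_on_cell_of hVB (by norm_num) (by norm_num) (by norm_num))
    (fun s hs => lsco_n1_lawAt_of hK29 hK8 h21 h487 h427 h488 h472 h428 (U₀ := 79 / 10) (by norm_num) s
      ⟨hs.1.trans' (by norm_num), hs.2⟩)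
    (fun s hs => lsco_n1_law8_of hK8 h472 h428 s ⟨hs.1.trans' (by norm_num), hs.2⟩)
    (fun s hs U hU => strip_dilute3o10_floor (n₁ := 3 / 10) (by norm_num) (by norm_num) s hs U (by linarith [hU.1]))
    (strip_freeDiluteCap_3o10 (by norm_num) (by norm_num) (by norm_num))
    (lsco_hotCap_n1_b3o4_j290715_on_band hLL (by norm_num) (by norm_num) (by norm_num))
    ?_ ?_ ?_ ?_ hs hU h₁ h₂ hρ₁ hρ₁' hρ₂ hρ₂' hn0 hn2 hl0 hl1 hLs
  · intro s hs; obtain ⟨h1, h2⟩ := hs; push_cast; norm_num; nlinarith [h1, h2]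
  · intro s hs; obtain ⟨h1, h2⟩ := hs; push_cast; norm_num; nlinarith [h1, h2]
  · intro s hs; obtain ⟨h1, h2⟩ := hs; push_cast; norm_num; nlinarith [h1, h2]
  · intro s hs; obtain ⟨h1, h2⟩ := hs; push_cast; norm_num; nlinarith [h1, h2]

/-- **`(≤ 3/10 | ≥ 1)` above `[8, 81/10]`, every `β ≥ 31`** (`β₀ = 30.89`; g24 `42`). [cite: Israel1979, Thm. I.2.4] [cite: EmeryKivelsonLin1990, pp. 475–476] [cite: PoulinHastings2011, eqs. (3)–(8)] [cite: Griffiths1966, §II] [cite: Ruelle1969, §3.4] -/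
theorem strip78_psTF_3o10_above81o10_beta31 (hVB : cert_obx32x4tpm1o4D1200_openbox_32x4_N112_planes)
    (hK8 : cert_laBoxE_K2diag_GU8n1tpm3o10_j299783_up)
    (h472 : cert_r472_pb2_tl_upper_n1_U8) (h428 : cert_r428_hubSQ_hanK7R6_U8_r5_e4_so4blk)
    (hC1 : cert_feC1tt_stair221_tpm1o4_b3o2_j300793)
    {s : ℝ} (hs : s ∈ Icc (-1 / 5 : ℝ) 0) {U : ℝ} (hU : U ∈ Icc (8 : ℝ) (81 / 10))
    {β : ℝ} (hβ : (31 : ℝ) ≤ β)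
    {ω₁ ω₂ : InfVolFermionState 2} (h₁ : ω₁.IsTranslationInvariant) (h₂ : ω₂.IsTranslationInvariant)
    (hρ₁ : 0 < ω₁.density) (hρ₁' : ω₁.density ≤ 3 / 10) (hρ₂ : 1 ≤ ω₂.density) (hρ₂' : ω₂.density < 2)
    {n : ℝ} (hn0 : 0 < n) (hn2 : n < 2) {lam : ℝ} (hl0 : 0 < lam) (hl1 : lam < 1) {Ls : ℕ → ℕ}
    (hLs : Tendsto Ls atTop atTop) :
    ¬ (mix lam hl0.le hl1.le ω₁ ω₂).IsTorusLimitOfMixture (sectorGibbsCount n) (fun L => sectorGibbsWeightTT' β 1 s U n L)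
      (fun L => sectorGibbsVectorTT' 1 s U n L) Ls := by
  refine psT_not_thermal_mix_above_column_hotAnchorSS 1 (s₁ := -1 / 5) (s₂ := 0) (U₂ := 8) (U₃ := 81 / 10)
    (n₁ := 3 / 10) (n₂ := 1) (a := 5 / 28) (b := 23 / 28) (β₀ := 31) (βh₁ := 8) (βh₂ := 3 / 2)
    (by norm_num) (by norm_num) (by norm_num) (by norm_num) (by norm_num) (by norm_num) (by norm_num) (by norm_num)
    (by norm_num) (by norm_num) (by norm_num) (by norm_num) hβ (by norm_num)
    (lsco78_capPlane_on_cell_of hVB (by norm_num) (by norm_num) (by norm_num))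
    (fun s hs => lsco_n1_law8_of hK8 h472 h428 s ⟨hs.1.trans' (by norm_num), hs.2⟩)
    (fun s hs U hU => strip_dilute3o10_floor (n₁ := 3 / 10) (by norm_num) (by norm_num) s hs U (by linarith [hU.1]))
    (strip_freeDiluteCap_3o10 (by norm_num) (by norm_num) (by norm_num))
    (lsco_hotCap_n1_b3o2_j300793_on_cell hC1 (by norm_num) (by norm_num) (by norm_num))
    ?_ ?_ hs hU h₁ h₂ hρ₁ hρ₁' hρ₂ hρ₂' hn0 hn2 hl0 hl1 hLs
  · intro s hs; obtain ⟨h1, h2⟩ := hs; push_cast; norm_num; nlinarith [h1, h2]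
  · intro s hs; obtain ⟨h1, h2⟩ := hs; push_cast; norm_num; nlinarith [h1, h2]

/-- **`(≤ 3/10 | ≥ 1)` on `t′ ∈ [−1/5, 0] × U ∈ [79/10, 81/10]`, every `β ≥ 45`** (g24: `55`) — `T ≲ 88–103 K`. [cite: Israel1979, Thm. I.2.4] [cite: EmeryKivelsonLin1990, pp. 475–476] [cite: PoulinHastings2011, eqs. (3)–(8)] [cite: Griffiths1966, §II] [cite: Ruelle1969, §3.4] -/
theorem strip78_not_thermal_mix_le_3o10_ge_one_beta45_freeDilute (hVB : cert_obx32x4tpm1o4D1200_openbox_32x4_N112_planes)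
    (hK29 : cert_laBoxE_K2diag_GU29o5n1tpm3o10_j295889_up) (hK8 : cert_laBoxE_K2diag_GU8n1tpm3o10_j299783_up)
    (h21 : cert_r21_luc_tl_upper_n1_U6) (h487 : cert_r487_hubSQ_hanK7R6_U10_r5_e4_so4blk)
    (h427 : cert_r427_hubSQ_hanK7_U5_r5_e4_so4blk) (h488 : cert_r488_hubSQ_hanK7R6_U6_r5_e4_so4blk)
    (h472 : cert_r472_pb2_tl_upper_n1_U8) (h428 : cert_r428_hubSQ_hanK7R6_U8_r5_e4_so4blk)
    (hLL : cert_feC1tt_3x2_tpm5o16_U15o2_b3o4_j290715) (hC1 : cert_feC1tt_stair221_tpm1o4_b3o2_j300793)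
    {s : ℝ} (hs : s ∈ Icc (-1 / 5 : ℝ) 0) {U : ℝ} (hU : U ∈ Icc (79 / 10 : ℝ) (81 / 10))
    {β : ℝ} (hβ : (45 : ℝ) ≤ β)
    {ω₁ ω₂ : InfVolFermionState 2} (h₁ : ω₁.IsTranslationInvariant) (h₂ : ω₂.IsTranslationInvariant)
    (hρ₁ : 0 < ω₁.density) (hρ₁' : ω₁.density ≤ 3 / 10) (hρ₂ : 1 ≤ ω₂.density) (hρ₂' : ω₂.density < 2)
    {n : ℝ} (hn0 : 0 < n) (hn2 : n < 2) {lam : ℝ} (hl0 : 0 < lam) (hl1 : lam < 1) {Ls : ℕ → ℕ}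
    (hLs : Tendsto Ls atTop atTop) :
    ¬ (mix lam hl0.le hl1.le ω₁ ω₂).IsTorusLimitOfMixture (sectorGibbsCount n) (fun L => sectorGibbsWeightTT' β 1 s U n L)
      (fun L => sectorGibbsVectorTT' 1 s U n L) Ls := by
  rcases le_total U 8 with hUl | hUr
  · exact strip78_psTF_3o10_columns79o10_beta45 hVB hK29 hK8 h21 h487 h427 h488 h472 h428 hLL hs ⟨hU.1, hUl⟩ (hβ.trans' (by norm_num)) h₁ h₂ hρ₁ hρ₁' hρ₂ hρ₂' hn0 hn2 hl0 hl1 hLs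
  · exact strip78_psTF_3o10_above81o10_beta31 hVB hK8 h472 h428 hC1 hs ⟨hUr, hU.2⟩ (hβ.trans' (by norm_num)) h₁ h₂ hρ₁ hρ₁' hρ₂ hρ₂' hn0 hn2 hl0 hl1 hLs

end Summit.Ventures.CertifiedManyBodySolver.Observables
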